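import Mathlib
import Literature.MathematicalPhysics.QuantumFieldTheory.Balaban1983to89.BlockAveragingPlaquetteBoundLocal
import Literature.MathematicalPhysics.QuantumFieldTheory.Balaban1983to89.B14Eq22Determines
import Literature.MathematicalPhysics.QuantumFieldTheory.Balaban1983to89.TorusGeometry

/-!
# Route `CoarseStiffnessTail` — [Balaban1985Averaging] PROP. 1 (LOCAL FORM) ITERATED ALONG THE AVERAGING TOWER: a `θ`-large plaquette
# of the `k`-fold block-averaged field `Ū^k = M^k(U)` forces a `θ/C₁^k`-large FINE plaquette within `k`-fold block distance `k`
# (lead's certificate, seat `ym-line-cst-p1` g13; helper on crux stmt-QuantumFields-25301, file 1 of 2)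

THE POINT.  The registered EDGE stub `stub_uniformLargeFieldCountPos` of crux `CappedCoarseStiffnessL` (skeleton v5,
`Cruxes/CappedCoarseStiffnessL/Lines/birth.lean`) asks for the exponential moment of the count of `θ(K−j)`-large plaquettes of the
`j`-fold AVERAGED field `Ū^j`, `1 ≤ j ≤ K`, with ONE rate constant `c₀` for all depths `j`.  Its bare face `j = 0` is a theorem
(`CoarseStiffnessTailBareUniformCount.bare_uniformLargeFieldCount`, p645503: joint Peierls–chessboard at the finest height).  To reach the
averaged heights by the same elementary road one needs a deterministic statement converting a large AVERAGED plaquette into a large FINE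
plaquette nearby.  The tree holds [Balaban1985Averaging] Prop. 1 for Bałaban's (0.4) averaging `blockAvg expMeanLogSU` in LOCAL form, ONE step
(`BlockAveragingPlaquetteBoundLocal.dist1_plaqHol_avgFun_lt_of_near`, cell `ym3-torus`): if every plaquette of `T^{(j)}` based in the blocks at
`ℓ^∞`-distance `≤ 1` from the corner of a plaquette `p′` of `T^{(j+1)}` is within `a` of `1` (and `((d+2)L)²a/4 < δ_N`), then
`|Ū(∂p′) − 1| < C₁·a`, `C₁ = L² + 6((d+2)L)²` (`= 151L²` for `d = 3`).  THIS FILE iterates it `k` times (definition-free; the `k`-fold block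
map is the tree's `B14.Eq22Determines.blockIter`):

* §1 torus-label geometry: **`blockOf_near`** — the block map `T^{(i)} → T^{(i+1)}` is `1`-LIPSCHITZ for coordinatewise integer offsets
  (`z_κ = w_κ + t ⇒ (blockOf z)_κ = (blockOf w)_κ + t′`, `|t′| ≤ |t|`: floor division by `L` on labels, standing range; the engine is
  `ediv_sub_ediv_le`); **`near_blockIter_succ`** — offsets compose along the tower (radius `r` at level `k` and `1` more step give radius
  `r + 1` at level `k + 1`);
* §2 ★★ **`dist1_plaqHol_iter_lt_of_near`** — for EVERY `Params`, every `SU(N)`, every `k ≤ m + K`, every `a ≥ 0` with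
  `((d+2)L)²·C₁^{k−1}a/4 < δ_N`: if every FINE plaquette `q` whose `k`-fold block `blockIter k q₋` is within coordinatewise offset `k` of the
  corner `y = p₋` of a plaquette `p` of `T^{(k)}` satisfies `|U(∂q) − 1| < a`, then `|Ū^k(∂p) − 1| < C₁^k·a` (`Ū^k = Averaging.iter blockAvg k U`);
  ★★ **`exists_fine_ge_of_le_dist1_iter`** — the contrapositive: `C₁^k·a ≤ |Ū^k(∂p) − 1|` forces a fine plaquette `q` in that region with
  `a ≤ |U(∂q) − 1|`.

READING (line card `Cruxes/CappedCoarseStiffnessL/Lines/birth.md` §g13).  This is the MAX-CURRENCY transfer from averaged to fine plaquettes: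
the threshold drops by `C₁ = 151L²` per level while the Peierls rate of the fine Wilson law at threshold `a` is `β_K a²/4`; with
`β_Kθ(K−j)² = L^j p(g_{K−j})²` the net rate per large level-`j` plaquette is `p(g_{K−j})²·(L/C₁²)^j/4` — geometrically DECAYING in the depth
`j` (file 2, `…LAveragedJointPeierls`).  Hence the EDGE stub holds at every BOUNDED depth (file 2) and its located content is exactly the
NON-DECAY of the rate in `j` ([Balaban1985UV3] (71): `¼p(g_j)²` at every depth — multi-scale, not max-currency).

HONEST SCOPE.  Lattice bookkeeping on the tree's own objects; nothing of Bałaban's estimates is proved; the crux 25301 and `HistoryTailL` 19936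
stay OPEN; `YM3TorusSU2` (rung R3, a RECORD rung, not the Clay statement) is NOT proved; the Yang–Mills mass gap is NOT touched.

References: T. Bałaban, CMP **98** (1985) 17–51 [Balaban1985Averaging] (Prop. 1 (51) p.26); CMP **109** (1987) 249–301 [Balaban1987RG1]
((0.1) p.251, (0.4), (0.11) p.253); CMP **102** (1985) 255–275 [Balaban1985UV3] ((38)–(40) p.266, (71) p.273).
-/

noncomputable section

namespace Summit.QuantumFields.YangMills.Theorems.CoarseStiffnessTailIteratedProp1

open Literature.MathematicalPhysics.QuantumFieldTheory
open Literature.MathematicalPhysics.QuantumFieldTheory.Balaban1983to89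
open Literature.MathematicalPhysics.QuantumFieldTheory.Balaban1983to89.B14.Eq22Determines (blockIter blockIter_succ blockIter_zero)
open Literature.MathematicalPhysics.QuantumFieldTheory.Balaban1983to89.BlockAveraging (avgFun blockAvg blockAvg_avg)
open Literature.MathematicalPhysics.QuantumFieldTheory.Balaban1983to89.ExpMeanLog (expMeanLogSU deltaSU)

/-! ## §1 Label geometry: the block map is `1`-Lipschitz for coordinatewise offsets, and offsets compose along the tower -/

section Geometry

/-- Floor division by a positive integer is `1`-Lipschitz: `|(b + t)/L − b/L| ≤ |t|` (`ℤ`, Euclidean `/`, `0 < L`). [folklore] -/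
theorem ediv_sub_ediv_le {L : ℤ} (hL : 0 < L) (b t : ℤ) : |(b + t) / L - b / L| ≤ |t| := by
  have hL1 : 1 ≤ L := hL
  rcases le_or_gt 0 t with ht | ht
  · -- `b/L ≤ (b+t)/L ≤ (b + tL)/L = b/L + t`
    have h1 : b / L ≤ (b + t) / L := Int.ediv_le_ediv hL (by linarith)
    have h2 : (b + t) / L ≤ b / L + t := by
      have : (b + t) / L ≤ (b + t * L) / L := Int.ediv_le_ediv hL (by nlinarith)
      rwa [Int.add_mul_ediv_right _ _ hL.ne'] at this
    rw [abs_of_nonneg (by linarith), abs_of_nonneg ht]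
    linarith
  · have h1 : (b + t) / L ≤ b / L := Int.ediv_le_ediv hL (by linarith)
    have h2 : b / L + t ≤ (b + t) / L := by
      have : (b + t * L) / L ≤ (b + t) / L := Int.ediv_le_ediv hL (by nlinarith)
      rwa [Int.add_mul_ediv_right _ _ hL.ne'] at this
    rw [abs_of_nonpos (by linarith), abs_of_neg ht]
    linarith

variable {P : Params}

/-- **THE BLOCK MAP IS `1`-LIPSCHITZ FOR COORDINATEWISE OFFSETS** (standing range `i + 1 ≤ m + K`): if `z_κ = w_κ + t` on the torus
`T^{(i)}` (`t ∈ ℤ`), then `(blockOf z)_κ = (blockOf w)_κ + t′` on `T^{(i+1)}` for some `t′ ∈ ℤ` with `|t′| ≤ |t|` — the labels of `blockOf`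
are the labels divided by `L` (`Site.val_blockOf`), the site counts satisfy `|T^{(i)}| = L·|T^{(i+1)}|` per direction, and floor division is
`1`-Lipschitz (`ediv_sub_ediv_le`). [cite: Balaban1987RG1, (0.1) p.251] -/
theorem blockOf_near {i : ℕ} (hi : i + 1 ≤ P.m + P.K) {z w : Site P i} {κ : Fin P.d} {t : ℤ}
    (h : z κ = w κ + (t : ZMod (P.sitesPerDir i))) :
    ∃ t' : ℤ, |t'| ≤ |t| ∧ blockOf z κ = blockOf w κ + (t' : ZMod (P.sitesPerDir (i + 1))) := by
  set n : ℕ := P.sitesPerDir i with hn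
  set n' : ℕ := P.sitesPerDir (i + 1) with hn'
  have hnn' : n = n' * P.L := by rw [hn, hn', P.sitesPerDir_eq_mul_succ hi]
  have hL0 : (0 : ℤ) < (P.L : ℤ) := by exact_mod_cast P.L_pos
  set a : ℕ := (z κ).val with ha
  set b : ℕ := (w κ).val with hb
  -- `a ≡ b + t (mod n)`
  have hzw : ((a : ℤ) : ZMod n) = (((b : ℤ) + t : ℤ) : ZMod n) := by
    push_cast
    rw [ha, hb, ZMod.natCast_zmod_val, ZMod.natCast_zmod_val]
    exact h
  rw [ZMod.intCast_eq_intCast_iff_dvd_sub] at hzw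
  obtain ⟨e, he⟩ := hzw
  -- `a = b + t − e·n'·L`
  have hae : (a : ℤ) = (b : ℤ) + t - e * (n' : ℤ) * (P.L : ℤ) := by
    have : ((n : ℕ) : ℤ) = (n' : ℤ) * (P.L : ℤ) := by rw [hnn']; push_cast; ring
    rw [this] at he
    linarith
  -- the labels of the blocks
  have hva : ((blockOf z κ).val : ℤ) = (a : ℤ) / (P.L : ℤ) := by
    rw [Site.val_blockOf hi, ha]; exact Int.natCast_div _ _
  have hvb : ((blockOf w κ).val : ℤ) = (b : ℤ) / (P.L : ℤ) := by
    rw [Site.val_blockOf hi, hb]; exact Int.natCast_div _ _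
  refine ⟨((b : ℤ) + t) / (P.L : ℤ) - (b : ℤ) / (P.L : ℤ), ediv_sub_ediv_le hL0 _ _, ?_⟩
  -- `a/L = (b + t)/L − e·n'`
  have hdiv : (a : ℤ) / (P.L : ℤ) = ((b : ℤ) + t) / (P.L : ℤ) + (-(e * (n' : ℤ))) := by
    rw [hae, show (b : ℤ) + t - e * (n' : ℤ) * (P.L : ℤ) = (b : ℤ) + t + (-(e * (n' : ℤ))) * (P.L : ℤ) by ring,
      Int.add_mul_ediv_right _ _ hL0.ne']
  have hz' : (blockOf z κ : ZMod n') = (((blockOf z κ).val : ℤ) : ZMod n') := by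
    push_cast; rw [ZMod.natCast_zmod_val]
  have hw' : (blockOf w κ : ZMod n') = (((blockOf w κ).val : ℤ) : ZMod n') := by
    push_cast; rw [ZMod.natCast_zmod_val]
  rw [hz', hw', hva, hvb, hdiv]
  push_cast
  rw [ZMod.natCast_self]
  ring

/-- The three-valued nearness of the one-step lemma from an offset of modulus `≤ 1`. [folklore] -/
theorem near_one_cases {i : ℕ} {u v : Site P i} {κ : Fin P.d} {t : ℤ} (ht : |t| ≤ 1)
    (h : u κ = v κ + (t : ZMod (P.sitesPerDir i))) :
    u κ = v κ ∨ u κ = v κ + 1 ∨ u κ = v κ - 1 := by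
  have h3 : t = 0 ∨ t = 1 ∨ t = -1 := by
    rcases abs_le.mp ht with ⟨h1, h2⟩
    omega
  rcases h3 with rfl | rfl | rfl
  · left; simpa using h
  · right; left; simpa using h
  · right; right; rw [h]; push_cast; ring

/-- **OFFSETS COMPOSE ALONG THE TOWER**: if the `k`-fold block of the fine site `x` is within coordinatewise offset `r` of `y′ ∈ T^{(k)}` and
`blockOf y′` is within offset `1` of `y ∈ T^{(k+1)}` (the one-step nearness of [Balaban1985Averaging] Prop. 1 local), then the `(k+1)`-fold block
of `x` is within offset `r + 1` of `y` (standing range `k + 1 ≤ m + K`). [cite: Balaban1987RG1, (0.1) and (0.11) pp.251-253] -/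
theorem near_blockIter_succ {k : ℕ} (hk : k + 1 ≤ P.m + P.K) {x : Site P 0} {y' : Site P k} {y : Site P (k + 1)} {r : ℕ}
    (h1 : ∀ κ, ∃ t : ℤ, |t| ≤ (r : ℤ) ∧ blockIter k x κ = y' κ + (t : ZMod (P.sitesPerDir k)))
    (h2 : ∀ κ, blockOf y' κ = y κ ∨ blockOf y' κ = y κ + 1 ∨ blockOf y' κ = y κ - 1) :
    ∀ κ, ∃ t : ℤ, |t| ≤ ((r + 1 : ℕ) : ℤ) ∧ blockIter (k + 1) x κ = y κ + (t : ZMod (P.sitesPerDir (k + 1))) := by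
  intro κ
  obtain ⟨t, ht, hx⟩ := h1 κ
  obtain ⟨t', ht', hb⟩ := blockOf_near hk hx
  -- the one-step offset `s ∈ {0, 1, −1}`
  have h2' : ∃ s : ℤ, |s| ≤ 1 ∧ blockOf y' κ = y κ + (s : ZMod (P.sitesPerDir (k + 1))) := by
    rcases h2 κ with h | h | h
    · exact ⟨0, by norm_num, by simpa using h⟩
    · exact ⟨1, by norm_num, by simpa using h⟩
    · exact ⟨-1, by norm_num, by rw [h]; push_cast; ring⟩
  obtain ⟨s, hs, hy⟩ := h2'
  refine ⟨t' + s, ?_, ?_⟩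
  · calc |t' + s| ≤ |t'| + |s| := abs_add_le _ _
      _ ≤ (r : ℤ) + 1 := add_le_add (ht'.trans ht) hs
      _ = ((r + 1 : ℕ) : ℤ) := by push_cast; ring
  · rw [blockIter_succ, hb, hy]
    push_cast
    ring

/-- The trivial offset: every site is within offset `r` of itself. [folklore] -/
theorem near_refl {i : ℕ} (u : Site P i) (r : ℕ) :
    ∀ κ, ∃ t : ℤ, |t| ≤ (r : ℤ) ∧ u κ = u κ + (t : ZMod (P.sitesPerDir i)) :=
  fun _ => ⟨0, by simp, by simp⟩

end Geometry

/-! ## §2 The iterated local Prop. 1 and its contrapositive -/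

section Iteration

variable {P : Params} {n : Type*} [Fintype n] [DecidableEq n] [Nonempty n]

/-- The one-step constant `C₁ = L² + 6((d+2)L)²` is at least `1`. [folklore] -/
theorem one_le_C₁ : (1 : ℝ) ≤ (P.L : ℝ) ^ 2 + 6 * (((P.d + 2) * P.L : ℕ) : ℝ) ^ 2 := by
  have hL : (1 : ℝ) ≤ (P.L : ℝ) := by exact_mod_cast P.L_pos
  nlinarith [sq_nonneg (((P.d + 2) * P.L : ℕ) : ℝ)]

/-- **[Balaban1985Averaging] PROP. 1 IN LOCAL FORM, ITERATED `k` TIMES.**  For every `Params`, every `SU(N)`, every `k ≤ m + K`, every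
`a ≥ 0` with `((d+2)L)²·C₁^{k−1}·a/4 < δ_N` (`C₁ = L² + 6((d+2)L)²`): if every fine plaquette `q` of `T^{(0)}` whose `k`-fold block
`blockIter k q₋` is within coordinatewise integer offset `k` of the corner `p₋` of a plaquette `p` of `T^{(k)}` satisfies `|U(∂q) − 1| < a`,
then the `k`-fold (0.4) average `Ū^k = M^k(U)` (`Averaging.iter blockAvg k`, small-loop average `exp[mean log]` on `SU(N)`) satisfies
`|Ū^k(∂p) − 1| < C₁^k·a`.  Induction on `k`: the one-step local Prop. 1 (`BlockAveragingPlaquetteBoundLocal.dist1_plaqHol_avgFun_lt_of_near`)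
at level `k` with smallness `C₁^k a`, its hypothesis supplied by the induction hypothesis at the `3^d` neighbouring corners through §1.
[cite: Balaban1985Averaging, Prop. 1 (51) p.26; Balaban1987RG1, (0.4) and (0.11) p.253] -/
theorem dist1_plaqHol_iter_lt_of_near : ∀ (k : ℕ), k ≤ P.m + P.K → ∀ {a : ℝ}, 0 ≤ a →
    ((((P.d + 2) * P.L : ℕ) : ℝ) ^ 2 / 4) * (((P.L : ℝ) ^ 2 + 6 * (((P.d + 2) * P.L : ℕ) : ℝ) ^ 2) ^ (k - 1) * a) < deltaSU n →
    ∀ (U : GaugeField P 0 (Matrix.specialUnitaryGroup n ℂ)) (p : Plaq P k),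
    (∀ q : Plaq P 0, (∀ κ, ∃ t : ℤ, |t| ≤ (k : ℤ) ∧ blockIter k q.src κ = p.src κ + (t : ZMod (P.sitesPerDir k))) →
      GaugeGroup.dist1 (GaugeField.plaqHol U q) < a) →
    GaugeGroup.dist1 (GaugeField.plaqHol
        (Averaging.iter (fun i => blockAvg (P := P) (j := i) (expMeanLogSU (n := n))) k U) p) <
      ((P.L : ℝ) ^ 2 + 6 * (((P.d + 2) * P.L : ℕ) : ℝ) ^ 2) ^ k * a := by
  intro k
  induction k with
  | zero =>
    intro _ a _ _ U p hU
    have h := hU p (near_refl p.src 0)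
    simpa [Averaging.iter] using h
  | succ k ih =>
    intro hk a ha ht U p hU
    set C₁ : ℝ := (P.L : ℝ) ^ 2 + 6 * (((P.d + 2) * P.L : ℕ) : ℝ) ^ 2 with hC₁
    have hC₁1 : 1 ≤ C₁ := one_le_C₁
    have hCka : 0 ≤ C₁ ^ k * a := mul_nonneg (pow_nonneg (zero_le_one.trans hC₁1) _) ha
    -- the guard at level `k` is the hypothesis (`(k+1) − 1 = k`); the guard for the induction hypothesis is weaker
    have htk : ((((P.d + 2) * P.L : ℕ) : ℝ) ^ 2 / 4) * (C₁ ^ k * a) < deltaSU n := by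
      simpa [hC₁] using ht
    have htih : ((((P.d + 2) * P.L : ℕ) : ℝ) ^ 2 / 4) * (C₁ ^ (k - 1) * a) < deltaSU n := by
      refine lt_of_le_of_lt ?_ htk
      have hpow : C₁ ^ (k - 1) ≤ C₁ ^ k := pow_le_pow_right₀ hC₁1 (Nat.sub_le k 1)
      exact mul_le_mul_of_nonneg_left (mul_le_mul_of_nonneg_right hpow ha) (by positivity)
    -- the field at level `k` and its plaquettes near the `3^d` corners around `p₋`
    set V : GaugeField P k (Matrix.specialUnitaryGroup n ℂ) :=
      Averaging.iter (fun i => blockAvg (P := P) (j := i) (expMeanLogSU (n := n))) k U with hV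
    have hV' : ∀ q' : Plaq P k, (∀ κ, blockOf q'.src κ = p.src κ ∨ blockOf q'.src κ = p.src κ + 1 ∨
        blockOf q'.src κ = p.src κ - 1) → GaugeGroup.dist1 (GaugeField.plaqHol V q') < C₁ ^ k * a := by
      intro q' hq'
      have := ih (by omega) ha (by simpa [hC₁] using htih) U q' (fun q hq => hU q (near_blockIter_succ hk hq hq'))
      simpa [hC₁, hV] using this
    have hstep := BlockAveragingPlaquetteBoundLocal.dist1_plaqHol_avgFun_lt_of_near (n := n) hk hCka p hV' htk
    have hiter : Averaging.iter (fun i => blockAvg (P := P) (j := i) (expMeanLogSU (n := n))) (k + 1) U =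
        avgFun (expMeanLogSU (n := n)) V := rfl
    rw [hiter, pow_succ]
    calc GaugeGroup.dist1 (GaugeField.plaqHol (avgFun (expMeanLogSU (n := n)) V) p)
        < C₁ * (C₁ ^ k * a) := hstep
      _ = C₁ ^ k * C₁ * a := by ring

/-- **THE CONTRAPOSITIVE: A LARGE AVERAGED PLAQUETTE FORCES A LARGE FINE PLAQUETTE NEARBY.**  Same data; if `C₁^k·a ≤ |Ū^k(∂p) − 1|`
then some fine plaquette `q` with `blockIter k q₋` within coordinatewise offset `k` of `p₋` has `a ≤ |U(∂q) − 1|`.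
[cite: Balaban1985Averaging, Prop. 1 (51) p.26; Balaban1985UV3, (38)-(40) p.266] -/
theorem exists_fine_ge_of_le_dist1_iter (k : ℕ) (hk : k ≤ P.m + P.K) {a : ℝ} (ha : 0 ≤ a)
    (ht : ((((P.d + 2) * P.L : ℕ) : ℝ) ^ 2 / 4) * (((P.L : ℝ) ^ 2 + 6 * (((P.d + 2) * P.L : ℕ) : ℝ) ^ 2) ^ (k - 1) * a) <
      deltaSU n)
    (U : GaugeField P 0 (Matrix.specialUnitaryGroup n ℂ)) (p : Plaq P k)
    (h : ((P.L : ℝ) ^ 2 + 6 * (((P.d + 2) * P.L : ℕ) : ℝ) ^ 2) ^ k * a ≤ GaugeGroup.dist1 (GaugeField.plaqHol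
        (Averaging.iter (fun i => blockAvg (P := P) (j := i) (expMeanLogSU (n := n))) k U) p)) :
    ∃ q : Plaq P 0, (∀ κ, ∃ t : ℤ, |t| ≤ (k : ℤ) ∧ blockIter k q.src κ = p.src κ + (t : ZMod (P.sitesPerDir k))) ∧
      a ≤ GaugeGroup.dist1 (GaugeField.plaqHol U q) := by
  by_contra hcon
  push Not at hcon
  have hlt := dist1_plaqHol_iter_lt_of_near k hk ha ht U p (fun q hq => hcon q hq)
  exact absurd h (not_le.mpr hlt)

end Iteration

end Summit.QuantumFields.YangMills.Theorems.CoarseStiffnessTailIteratedProp1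

end
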